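import Summits.NavierStokesRegularity.NavierStokesRegularity.Theses.WakeRatchet
import Summits.NavierStokesRegularity.NavierStokesRegularity.Theorems.TaoLadderRungTwoBreakDSSWaveOfQuadTermDatum
import Summits.NavierStokesRegularity.NavierStokesRegularity.Theorems.WakeRatchetAdmissibleEternalBoundCritical

/-!
# WakeRatchetExtractionAscoli — LINE g9-1 «clocked frames», part 1/7: ⟨22744⟩ `WakeRatchet.MinimalBlowupExtraction`

Ideator ns-idea-1 g9, LINE g9-1 «clocked frames» (critic of record idea-crit-3): part 1 of 7 of the split landing kit of
`extraction_proved.lean` (sha16 849d037365163546, the sorry-free proof of route item ⟨stmt-NavierStokesRegularity-22744⟩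
`WakeRatchet.MinimalBlowupExtraction`), cut at the author's seams with every declaration VERBATIM; parts chain by import
(1 Ascoli → 2 Frames → 3 FrameLip → 4 Action → 5 Law → 6 Clock → 7 MinimalBlowupExtraction).  MODEL lattice only
(Tao 2016 averaged Navier–Stokes cascade); no summit is proved by a line — part 7 closes ONE crux (K2) of route WakeRatchet.

This part: Abstract extraction with continuous convergence (Arzelà–Ascoli on half-lines for shell-indexed paths in a proper space:
Tychonoff on the countable index `ℤ × ℚ`, diagonal subsequence, equi-Lipschitz upgrade; a bounded real parameter is extracted
along the same subsequence) and limits through the table maps `Q`, `A`, `B` in lambda form.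
-/

noncomputable section

set_option linter.dupNamespace false

namespace Summit.NavierStokesRegularity.NavierStokesRegularity.Cruxes.MinimalBlowupExtraction.Extraction

open Set Filter Topology

variable {E : Type*} [NormedAddCommGroup E]

/-- A Lipschitz bound with constant `K` is one with constant `max K 1`. -/
theorem lip_max {K x y : ℝ} {a b : E} (h : ‖a - b‖ ≤ K * |x - y|) : ‖a - b‖ ≤ max K 1 * |x - y| :=
  le_trans h (mul_le_mul_of_nonneg_right (le_max_left K 1) (abs_nonneg _))

variable [ProperSpace E]

/-- **Abstract extraction with continuous convergence.**  A sequence of shell-indexed paths `g j : ℤ → ℝ → E` in a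
proper space which is, for every shell `n` and every half-line `[a, ∞)`, eventually (in `j`) uniformly bounded and
eventually equi-Lipschitz, has a subsequence converging CONTINUOUSLY (`u_j → σ ⇒ g (φ j) n u_j → W n σ`) to some
`W : ℤ → ℝ → E`. -/
theorem exists_subseq_continuousLimit (g : ℕ → ℤ → ℝ → E)
    (hB : ∀ (n : ℤ) (a : ℝ), ∃ C : ℝ, ∃ J : ℕ, ∀ j, J ≤ j → ∀ u : ℝ, a ≤ u → ‖g j n u‖ ≤ C)
    (hL : ∀ (n : ℤ) (a : ℝ), ∃ K : ℝ, ∃ J : ℕ, ∀ j, J ≤ j → ∀ u v : ℝ, a ≤ u → a ≤ v →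
      ‖g j n u - g j n v‖ ≤ K * |u - v|) :
    ∃ φ : ℕ → ℕ, StrictMono φ ∧ ∃ W : ℤ → ℝ → E, ∀ (n : ℤ) (u : ℕ → ℝ) (σ : ℝ),
      Tendsto u atTop (𝓝 σ) → Tendsto (fun j => g (φ j) n (u j)) atTop (𝓝 (W n σ)) := by
  classical
  -- Step 1: every coordinate sequence `j ↦ g j n q` lies in a fixed closed ball
  have hR : ∀ i : ℤ × ℚ, ∃ R : ℝ, ∀ j, g j i.1 (i.2 : ℝ) ∈ Metric.closedBall (0 : E) R := by
    rintro ⟨n, q⟩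
    obtain ⟨C, J, hC⟩ := hB n q
    refine ⟨C + ∑ j ∈ Finset.range J, ‖g j n q‖, fun j => ?_⟩
    rw [Metric.mem_closedBall, dist_zero_right]
    have hs : 0 ≤ ∑ j ∈ Finset.range J, ‖g j n q‖ := Finset.sum_nonneg fun _ _ => norm_nonneg _
    have h0 : 0 ≤ C := le_trans (norm_nonneg _) (hC J le_rfl q le_rfl)
    by_cases hj : J ≤ j
    · have h1 := hC j hj (q : ℝ) le_rfl
      simp only
      linarith
    · push Not at hj
      have h1 : ‖g j n q‖ ≤ ∑ j ∈ Finset.range J, ‖g j n q‖ :=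
        Finset.single_le_sum (f := fun j => ‖g j n (q : ℝ)‖) (fun _ _ => norm_nonneg _)
          (Finset.mem_range.2 hj)
      simp only
      linarith
  choose R hR using hR
  -- Step 2: Tychonoff on the countable product + sequential compactness ⇒ pointwise convergence at rationals
  set G : ℕ → (ℤ × ℚ → E) := fun j i => g j i.1 i.2 with hG
  have hS : IsCompact (Set.pi Set.univ fun i : ℤ × ℚ => Metric.closedBall (0 : E) (R i)) :=
    isCompact_univ_pi fun i => isCompact_closedBall _ _
  have hGS : ∀ j, G j ∈ Set.pi Set.univ fun i : ℤ × ℚ => Metric.closedBall (0 : E) (R i) :=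
    fun j => Set.mem_univ_pi.2 fun i => hR i j
  obtain ⟨A, -, φ, hφ, hlim⟩ := hS.tendsto_subseq hGS
  have hpt : ∀ (n : ℤ) (q : ℚ), Tendsto (fun j => g (φ j) n q) atTop (𝓝 (A (n, q))) := by
    intro n q
    have h := tendsto_pi_nhds.1 hlim (n, q)
    simpa [hG, Function.comp_def] using h
  refine ⟨φ, hφ, ?_⟩
  have hφle : ∀ j, j ≤ φ j := fun j => hφ.id_le j
  -- Step 3: the subsequence is Cauchy at every real log-time (equi-Lipschitz upgrade)
  have hcauchy : ∀ (n : ℤ) (u : ℝ), CauchySeq fun j => g (φ j) n u := by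
    intro n u
    rw [Metric.cauchySeq_iff]
    intro ε hε
    obtain ⟨K, J, hK⟩ := hL n (u - 1)
    have hK' : 0 < max K 1 := lt_of_lt_of_le one_pos (le_max_right K 1)
    have hδ : 0 < min 1 (ε / (4 * max K 1)) := by positivity
    obtain ⟨q, hq1, hq2⟩ := exists_rat_btwn (show u - min 1 (ε / (4 * max K 1)) < u by linarith)
    have hqu1 : u - 1 ≤ (q : ℝ) := by linarith [min_le_left 1 (ε / (4 * max K 1))]
    have hqu2 : |u - q| < ε / (4 * max K 1) := by
      rw [abs_of_nonneg (by linarith)]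
      linarith [min_le_right 1 (ε / (4 * max K 1))]
    obtain ⟨N, hN⟩ := Metric.cauchySeq_iff.1 (hpt n q).cauchySeq (ε / 2) (by positivity)
    refine ⟨max N J, fun j hj k hk => ?_⟩
    have hjJ : J ≤ φ j := le_trans (le_trans (le_max_right N J) hj) (hφle j)
    have hkJ : J ≤ φ k := le_trans (le_trans (le_max_right N J) hk) (hφle k)
    have h1 : ‖g (φ j) n u - g (φ j) n q‖ ≤ max K 1 * |u - q| :=
      lip_max (hK (φ j) hjJ u q (by linarith) hqu1)
    have h2 : dist (g (φ j) n q) (g (φ k) n q) < ε / 2 := hN j (le_trans (le_max_left N J) hj) k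
      (le_trans (le_max_left N J) hk)
    have h3 : ‖g (φ k) n q - g (φ k) n u‖ ≤ max K 1 * |(q : ℝ) - u| :=
      lip_max (hK (φ k) hkJ q u hqu1 (by linarith))
    have h4 : max K 1 * |u - q| < ε / 4 := by
      calc max K 1 * |u - q| < max K 1 * (ε / (4 * max K 1)) := mul_lt_mul_of_pos_left hqu2 hK'
        _ = ε / 4 := by field_simp
    rw [abs_sub_comm] at h3
    rw [dist_eq_norm] at h2 ⊢
    calc ‖g (φ j) n u - g (φ k) n u‖
        = ‖(g (φ j) n u - g (φ j) n q) + (g (φ j) n q - g (φ k) n q) + (g (φ k) n q - g (φ k) n u)‖ := by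
          congr 1; abel
      _ ≤ ‖g (φ j) n u - g (φ j) n q‖ + ‖g (φ j) n q - g (φ k) n q‖ + ‖g (φ k) n q - g (φ k) n u‖ :=
          norm_add₃_le
      _ < ε := by linarith
  -- Step 4: the limit and continuous convergence
  set W : ℤ → ℝ → E := fun n u => limUnder atTop fun j => g (φ j) n u with hWdef
  have hW : ∀ (n : ℤ) (u : ℝ), Tendsto (fun j => g (φ j) n u) atTop (𝓝 (W n u)) :=
    fun n u => tendsto_nhds_limUnder (cauchySeq_tendsto_of_complete (hcauchy n u))
  refine ⟨W, fun n u σ hu => ?_⟩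
  rw [Metric.tendsto_atTop]
  intro ε hε
  obtain ⟨K, J, hK⟩ := hL n (σ - 1)
  have hK' : 0 < max K 1 := lt_of_lt_of_le one_pos (le_max_right K 1)
  obtain ⟨J₁, hJ₁⟩ := Metric.tendsto_atTop.1 hu (min 1 (ε / (2 * max K 1))) (by positivity)
  obtain ⟨J₂, hJ₂⟩ := Metric.tendsto_atTop.1 (hW n σ) (ε / 2) (by positivity)
  refine ⟨max (max J₁ J₂) J, fun j hj => ?_⟩
  have hj1 : J₁ ≤ j := le_trans (le_trans (le_max_left _ _) (le_max_left _ _)) hj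
  have hj2 : J₂ ≤ j := le_trans (le_trans (le_max_right _ _) (le_max_left _ _)) hj
  have hjJ : J ≤ φ j := le_trans (le_trans (le_max_right _ _) hj) (hφle j)
  have hd := hJ₁ j hj1
  rw [Real.dist_eq] at hd
  have hd1 : |u j - σ| < 1 := lt_of_lt_of_le hd (min_le_left _ _)
  have hd2 : |u j - σ| < ε / (2 * max K 1) := lt_of_lt_of_le hd (min_le_right _ _)
  have hul : σ - 1 ≤ u j := by
    have := (abs_lt.1 hd1).1
    linarith
  have h1 : ‖g (φ j) n (u j) - g (φ j) n σ‖ ≤ max K 1 * |u j - σ| :=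
    lip_max (hK (φ j) hjJ (u j) σ hul (by linarith))
  have h2 : max K 1 * |u j - σ| < ε / 2 := by
    calc max K 1 * |u j - σ| < max K 1 * (ε / (2 * max K 1)) := mul_lt_mul_of_pos_left hd2 hK'
      _ = ε / 2 := by field_simp
  have h3 := hJ₂ j hj2
  rw [dist_eq_norm] at h3 ⊢
  calc ‖g (φ j) n (u j) - W n σ‖
      = ‖(g (φ j) n (u j) - g (φ j) n σ) + (g (φ j) n σ - W n σ)‖ := by congr 1; abel
    _ ≤ ‖g (φ j) n (u j) - g (φ j) n σ‖ + ‖g (φ j) n σ - W n σ‖ := norm_add_le _ _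
    _ < ε := by linarith

/-- **Abstract extraction with a parameter.**  As `exists_subseq_continuousLimit`, carrying a bounded real parameter
sequence `r j ∈ [ρ₁, ρ₂]` (the frames' renormalised viscosities) to a limit `νh ∈ [ρ₁, ρ₂]` along the SAME
subsequence. -/
theorem exists_subseq_continuousLimit_param (g : ℕ → ℤ → ℝ → E)
    (hB : ∀ (n : ℤ) (a : ℝ), ∃ C : ℝ, ∃ J : ℕ, ∀ j, J ≤ j → ∀ u : ℝ, a ≤ u → ‖g j n u‖ ≤ C)
    (hL : ∀ (n : ℤ) (a : ℝ), ∃ K : ℝ, ∃ J : ℕ, ∀ j, J ≤ j → ∀ u v : ℝ, a ≤ u → a ≤ v →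
      ‖g j n u - g j n v‖ ≤ K * |u - v|)
    (r : ℕ → ℝ) (ρ₁ ρ₂ : ℝ) (hr : ∀ j, r j ∈ Icc ρ₁ ρ₂) :
    ∃ φ : ℕ → ℕ, StrictMono φ ∧ (∃ νh : ℝ, νh ∈ Icc ρ₁ ρ₂ ∧ Tendsto (fun j => r (φ j)) atTop (𝓝 νh)) ∧
      ∃ W : ℤ → ℝ → E, ∀ (n : ℤ) (u : ℕ → ℝ) (σ : ℝ),
        Tendsto u atTop (𝓝 σ) → Tendsto (fun j => g (φ j) n (u j)) atTop (𝓝 (W n σ)) := by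
  -- first the parameter (Bolzano–Weierstrass), then the paths along the extracted subsequence
  obtain ⟨νh, hνmem, φ₀, hφ₀, hr0⟩ := tendsto_subseq_of_bounded (Metric.isBounded_Icc ρ₁ ρ₂) hr
  rw [closure_Icc] at hνmem
  have hφ₀le : ∀ j, j ≤ φ₀ j := fun j => hφ₀.id_le j
  have hB' : ∀ (n : ℤ) (a : ℝ), ∃ C : ℝ, ∃ J : ℕ, ∀ j, J ≤ j → ∀ u : ℝ, a ≤ u → ‖g (φ₀ j) n u‖ ≤ C := by
    intro n a
    obtain ⟨C, J, h⟩ := hB n a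
    exact ⟨C, J, fun j hj u hu => h (φ₀ j) (le_trans hj (hφ₀le j)) u hu⟩
  have hL' : ∀ (n : ℤ) (a : ℝ), ∃ K : ℝ, ∃ J : ℕ, ∀ j, J ≤ j → ∀ u v : ℝ, a ≤ u → a ≤ v →
      ‖g (φ₀ j) n u - g (φ₀ j) n v‖ ≤ K * |u - v| := by
    intro n a
    obtain ⟨K, J, h⟩ := hL n a
    exact ⟨K, J, fun j hj u v hu hv => h (φ₀ j) (le_trans hj (hφ₀le j)) u v hu hv⟩
  obtain ⟨φ₁, hφ₁, W, hW⟩ := exists_subseq_continuousLimit (fun j => g (φ₀ j)) hB' hL'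
  refine ⟨fun j => φ₀ (φ₁ j), hφ₀.comp hφ₁, ⟨νh, hνmem, ?_⟩, W, fun n u σ hu => hW n u σ hu⟩
  exact hr0.comp hφ₁.tendsto_atTop

end Summit.NavierStokesRegularity.NavierStokesRegularity.Cruxes.MinimalBlowupExtraction.Extraction

namespace Summit.NavierStokesRegularity.NavierStokesRegularity.Cruxes.MinimalBlowupExtraction.TableCont

/-! ## Limits through the table maps (stated in lambda form; the tables are kept irreducible while unifying) -/

open Filter Topology
open Literature.Analysis.FluidPDE Literature.Analysis.FluidPDE.TaoCascade

attribute [local irreducible] tableQ tableA tableB in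
/-- Limits pass through the table map `B` (continuity of `tableB`, in lambda form). -/
theorem tendsto_tableB_comp {m : ℕ} (α : Fin m → Fin m → Fin m → ℤ × ℤ × ℤ → ℝ) {ι : Type*} {l : Filter ι}
    {f g : ι → Em m} {a b : Em m} (hf : Tendsto f l (𝓝 a)) (hg : Tendsto g l (𝓝 b)) :
    Tendsto (fun i => tableB α (f i) (g i)) l (𝓝 (tableB α a b)) := by
  have hc := Summit.NavierStokesRegularity.NavierStokesRegularity.Theorems.WakeRatchetCritical.continuous_tableB α
  exact (hc.tendsto (a, b)).comp (hf.prodMk_nhds hg)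

attribute [local irreducible] tableQ tableA tableB in
/-- Limits pass through the table map `Q` (continuity of `tableQ`, in lambda form). -/
theorem tendsto_tableQ_comp {m : ℕ} (α : Fin m → Fin m → Fin m → ℤ × ℤ × ℤ → ℝ) {ι : Type*} {l : Filter ι}
    {f : ι → Em m} {a : Em m} (hf : Tendsto f l (𝓝 a)) :
    Tendsto (fun i => tableQ α (f i)) l (𝓝 (tableQ α a)) :=
  ((Summit.NavierStokesRegularity.NavierStokesRegularity.Theorems.TransitMassLedgerEnergy.continuous_tableQ
    α).tendsto a).comp hf

attribute [local irreducible] tableQ tableA tableB in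
/-- Limits pass through the table map `A` (continuity of `tableA`, in lambda form). -/
theorem tendsto_tableA_comp {m : ℕ} (α : Fin m → Fin m → Fin m → ℤ × ℤ × ℤ → ℝ) {ι : Type*} {l : Filter ι}
    {f : ι → Em m} {a : Em m} (hf : Tendsto f l (𝓝 a)) :
    Tendsto (fun i => tableA α (f i)) l (𝓝 (tableA α a)) :=
  ((Summit.NavierStokesRegularity.NavierStokesRegularity.Theorems.TransitMassLedgerEnergy.continuous_tableA
    α).tendsto a).comp hf

end Summit.NavierStokesRegularity.NavierStokesRegularity.Cruxes.MinimalBlowupExtraction.TableCont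

end
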